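import Summits.BirchSwinnertonDyer.BirchSwinnertonDyer.Theorems.KolyvaginDepthDoorKolyvaginDepthSupplyLeavesOfPrint
import Summits.BirchSwinnertonDyer.BirchSwinnertonDyer.Theorems.KolyvaginDepthDoorDepthTableRowsOfPrint4
import Summits.BirchSwinnertonDyer.BirchSwinnertonDyer.Theorems.KolyvaginDepthDoorDepthTableRowsOfPrint5
import HarnessLib

/-!
# Route `KolyvaginDepthDoor` — rank-2 TWIST-SELMER depth-table rows, rows `707a1`, `794a1`, `817a1`, `997b1`, ON (γ) + F1
# (crux `KolyvaginDepthSupply`, stmt-BirchSwinnertonDyer-21765) — part 3 of 4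

Helper file (`--supports stmt-BirchSwinnertonDyer-21765 --as helper`); it closes nothing and BSD is
not proved by it.

g6/g7's rows of this family display the FIVE named McCallum / Gross leaves (`h54 h43 h44 h53 h22`). After
g8 three of them are tree THEOREMS as stated (`sign_conjAct_kolyvaginClass_holds`,
`lemma53_selmer_eigen_dependent_at_holds`, `prop22_reciprocity_eigen_finset_holds`), Lemma 4.3 follows
from F1 = `Gross1991_heegnerPoint_sub_ratTorsion_mem_E0` ([GZ86 III (3.1)]) and Prop. 4.4 from
(γ) = `GrossLMS1991.prop37_2_frobeniusCongruence` (Gross 1991 Prop. 3.7 (2)) — packaged as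
`mcCallumLeaves_of_print` (file `…LeavesOfPrint`). This file re-issues the rows over the fed kit
`depthRow_twistSelmer_print_of_datum_of_intModel_certificate`: same per-curve certificates, binders `(h372 : (γ)) (hE0 : F1)` in place of the five
leaves. CONDITIONAL on (γ) + F1 and the bit; per-curve; BSD is not proved by it.
-/

set_option linter.dupNamespace false

noncomputable section

open scoped Classical NumberField

namespace Summit.BirchSwinnertonDyer.BirchSwinnertonDyer.Theorems.KolyvaginDepthDoor

open Literature.NumberTheory.EllipticCurves Literature.NumberTheory.EllipticCurves.ModularForms
  Literature.NumberTheory.EllipticCurves.McCallum1991 WeierstrassCurve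
open Summit.BirchSwinnertonDyer.BirchSwinnertonDyer.Rank2Observatory
open Summit.BirchSwinnertonDyer.BirchSwinnertonDyer.Rank1Residual

namespace C707a1

/-- **DEPTH-TABLE ROW `707a1`, `(p, d_K, ℓ) = (5, -19, 179)` — THE TWIST'S `5`-SELMER GROUP, without
Kolyvagin's structure theorem, without a point on the twist, and WITHOUT A SYSTEM.** Hypotheses
those of `C707a1.depthRow_5_neg19_179_print` ((γ) = Gross 3.7 (2) and F1 = [GZ86 III (3.1)] in place
of the five McCallum/Gross leaves, any imaginary quadratic `K` with `d_K = -19`, any frame, ANY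
single datum `d` of conductor `179` — NO system — and its bit `d.kolyvaginClass _ 1 ≠ 0`);
conclusion: `#Sel^(5)(E^{(-19)}/ℚ) ≤ 5` (i.e. `dim_𝔽5 Sel_5(E^{(-19)}/ℚ) ≤ 1`) and the descent count
`5^{rank E^{(-19)}(ℚ)} · #E^{(-19)}(ℚ)[5] · #Ш(E^{(-19)}/ℚ)[5] ≤ 5` — Kolyvagin's second eigen-bound
`#Sel(E/K)_5^- ≤ 5` read over `ℚ` (kit
`depthRow_twistSelmer_print_of_datum_of_intModel_certificate`; the compatible system through `d` is
the theorem `exists_kolyvaginHeegnerSystem_extending`); the hF-free, twist-point-free counterpart of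
the hF-row's `corank Sel_{5^∞}(E^{(-19)}/ℚ) = 1`. CONDITIONAL on (γ) + F1 and the bit; per-curve;
BSD is not proved by it. [cite: Kolyvagin1991MathAnn, Thm. 2.3] [cite: McCallumLMS1991, §§2–5]
[cite: GrossLMS1991, §5 (5.1)] [cite: JetchevLauterStein2009, §3.6 (arXiv:0707.0032)] -/
theorem twistSelmer_5_neg19_179_print
    (h372 : GrossLMS1991.prop37_2_frobeniusCongruence)
    (hE0 : Gross1991_heegnerPoint_sub_ratTorsion_mem_E0)
    (K : Type) [Field K] [NumberField K] (hK : IsImaginaryQuadratic K)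
    (hD : NumberField.discr K = -19) :
    haveI := isElliptic_c707a1;
    haveI := isGloballyMinimal_c707a1;
    haveI : NeZero (((⟨0, 1, 1, -12, 12⟩ : WeierstrassCurve ℤ).map (Int.castRingHom ℚ)).conductorNorm ℤ) :=
      neZero_conductorNorm_of_isElliptic _;
    ∀ (Dt : ModularParametrizationData ((⟨0, 1, 1, -12, 12⟩ : WeierstrassCurve ℤ).map (Int.castRingHom ℚ))
        (((⟨0, 1, 1, -12, 12⟩ : WeierstrassCurve ℤ).map (Int.castRingHom ℚ)).conductorNorm ℤ)) (β : ℤ)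
      (ι : K →+* ℂ) (d : KolyvaginHeegnerData Dt β ι 179),
    d.kolyvaginClass (p := 5) (by norm_num) 1 ≠ 0 →
    Nat.card ↥(selmerGroup (((⟨0, 1, 1, -12, 12⟩ : WeierstrassCurve ℤ).map (Int.castRingHom ℚ)).quadraticTwist
        ((-19 : ℤ) : ℚ)) ((5 : ℕ) : ℤ)) ≤ 5 ∧
      5 ^ (((⟨0, 1, 1, -12, 12⟩ : WeierstrassCurve ℤ).map (Int.castRingHom ℚ)).quadraticTwist
        ((-19 : ℤ) : ℚ)).mordellWeilRank *
          Nat.card ↥(AddSubgroup.torsionBy (((⟨0, 1, 1, -12, 12⟩ : WeierstrassCurve ℤ).map (Int.castRingHom ℚ)).quadraticTwist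
        ((-19 : ℤ) : ℚ)).toAffine.Point ((5 : ℕ) : ℤ)) *
          Nat.card ↥((((⟨0, 1, 1, -12, 12⟩ : WeierstrassCurve ℤ).map (Int.castRingHom ℚ)).quadraticTwist
        ((-19 : ℤ) : ℚ)).sha ⊓
            AddSubgroup.torsionBy (((⟨0, 1, 1, -12, 12⟩ : WeierstrassCurve ℤ).map (Int.castRingHom ℚ)).quadraticTwist
        ((-19 : ℤ) : ℚ)).galH1 ((5 : ℕ) : ℤ)) ≤ 5 := by
  haveI := isElliptic_c707a1
  haveI := isGloballyMinimal_c707a1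
  haveI : NeZero (((⟨0, 1, 1, -12, 12⟩ : WeierstrassCurve ℤ).map (Int.castRingHom ℚ)).conductorNorm ℤ) :=
    neZero_conductorNorm_of_isElliptic _
  intro Dt β ι d hne
  haveI := Fact.mk (by norm_num : Nat.Prime 5)
  exact depthRow_twistSelmer_print_of_datum_of_intModel_certificate intModel h372 hE0 not_hasCM
    KernelCerts002.C707a1.two_le_rank 5 (by norm_num) hasSurjectiveModNGaloisRep_pow_5 K hK hD
    (by norm_num) (by norm_num) heegner_neg19 179 (by norm_num) (by norm_num) (by decide +kernel)
    (by norm_num) (by norm_num) (by norm_num) (by norm_num) (n := 200) card_179 (by norm_num) Dt β ι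
    d hne

end C707a1

namespace C794a1

/-- **DEPTH-TABLE ROW `794a1`, `(p, d_K, ℓ) = (5, -23, 89)` — THE TWIST'S `5`-SELMER GROUP, without
Kolyvagin's structure theorem, without a point on the twist, and WITHOUT A SYSTEM.** Hypotheses
those of `C794a1.depthRow_5_neg23_89_print` ((γ) = Gross 3.7 (2) and F1 = [GZ86 III (3.1)] in place
of the five McCallum/Gross leaves, any imaginary quadratic `K` with `d_K = -23`, any frame, ANY
single datum `d` of conductor `89` — NO system — and its bit `d.kolyvaginClass _ 1 ≠ 0`);
conclusion: `#Sel^(5)(E^{(-23)}/ℚ) ≤ 5` (i.e. `dim_𝔽5 Sel_5(E^{(-23)}/ℚ) ≤ 1`) and the descent count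
`5^{rank E^{(-23)}(ℚ)} · #E^{(-23)}(ℚ)[5] · #Ш(E^{(-23)}/ℚ)[5] ≤ 5` — Kolyvagin's second eigen-bound
`#Sel(E/K)_5^- ≤ 5` read over `ℚ` (kit
`depthRow_twistSelmer_print_of_datum_of_intModel_certificate`; the compatible system through `d` is
the theorem `exists_kolyvaginHeegnerSystem_extending`); the hF-free, twist-point-free counterpart of
the hF-row's `corank Sel_{5^∞}(E^{(-23)}/ℚ) = 1`. CONDITIONAL on (γ) + F1 and the bit; per-curve;
BSD is not proved by it. [cite: Kolyvagin1991MathAnn, Thm. 2.3] [cite: McCallumLMS1991, §§2–5]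
[cite: GrossLMS1991, §5 (5.1)] [cite: JetchevLauterStein2009, §3.6 (arXiv:0707.0032)] -/
theorem twistSelmer_5_neg23_89_print
    (h372 : GrossLMS1991.prop37_2_frobeniusCongruence)
    (hE0 : Gross1991_heegnerPoint_sub_ratTorsion_mem_E0)
    (K : Type) [Field K] [NumberField K] (hK : IsImaginaryQuadratic K)
    (hD : NumberField.discr K = -23) :
    haveI := isElliptic_c794a1;
    haveI := isGloballyMinimal_c794a1;
    haveI : NeZero (((⟨1, 0, 1, -3, 2⟩ : WeierstrassCurve ℤ).map (Int.castRingHom ℚ)).conductorNorm ℤ) :=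
      neZero_conductorNorm_of_isElliptic _;
    ∀ (Dt : ModularParametrizationData ((⟨1, 0, 1, -3, 2⟩ : WeierstrassCurve ℤ).map (Int.castRingHom ℚ))
        (((⟨1, 0, 1, -3, 2⟩ : WeierstrassCurve ℤ).map (Int.castRingHom ℚ)).conductorNorm ℤ)) (β : ℤ)
      (ι : K →+* ℂ) (d : KolyvaginHeegnerData Dt β ι 89),
    d.kolyvaginClass (p := 5) (by norm_num) 1 ≠ 0 →
    Nat.card ↥(selmerGroup (((⟨1, 0, 1, -3, 2⟩ : WeierstrassCurve ℤ).map (Int.castRingHom ℚ)).quadraticTwist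
        ((-23 : ℤ) : ℚ)) ((5 : ℕ) : ℤ)) ≤ 5 ∧
      5 ^ (((⟨1, 0, 1, -3, 2⟩ : WeierstrassCurve ℤ).map (Int.castRingHom ℚ)).quadraticTwist
        ((-23 : ℤ) : ℚ)).mordellWeilRank *
          Nat.card ↥(AddSubgroup.torsionBy (((⟨1, 0, 1, -3, 2⟩ : WeierstrassCurve ℤ).map (Int.castRingHom ℚ)).quadraticTwist
        ((-23 : ℤ) : ℚ)).toAffine.Point ((5 : ℕ) : ℤ)) *
          Nat.card ↥((((⟨1, 0, 1, -3, 2⟩ : WeierstrassCurve ℤ).map (Int.castRingHom ℚ)).quadraticTwist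
        ((-23 : ℤ) : ℚ)).sha ⊓
            AddSubgroup.torsionBy (((⟨1, 0, 1, -3, 2⟩ : WeierstrassCurve ℤ).map (Int.castRingHom ℚ)).quadraticTwist
        ((-23 : ℤ) : ℚ)).galH1 ((5 : ℕ) : ℤ)) ≤ 5 := by
  haveI := isElliptic_c794a1
  haveI := isGloballyMinimal_c794a1
  haveI : NeZero (((⟨1, 0, 1, -3, 2⟩ : WeierstrassCurve ℤ).map (Int.castRingHom ℚ)).conductorNorm ℤ) :=
    neZero_conductorNorm_of_isElliptic _
  intro Dt β ι d hne
  haveI := Fact.mk (by norm_num : Nat.Prime 5)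
  exact depthRow_twistSelmer_print_of_datum_of_intModel_certificate intModel h372 hE0 not_hasCM
    KernelCerts002.C794a1.two_le_rank 5 (by norm_num) hasSurjectiveModNGaloisRep_pow_5 K hK hD
    (by norm_num) (by norm_num) heegner_neg23 89 (by norm_num) (by norm_num) (by decide +kernel)
    (by norm_num) (by norm_num) (by norm_num) (by norm_num) (n := 90) card_89 (by norm_num) Dt β ι
    d hne

end C794a1

namespace C817a1

/-- **DEPTH-TABLE ROW `817a1`, `(p, d_K, ℓ) = (5, -8, 239)` — THE TWIST'S `5`-SELMER GROUP, without
Kolyvagin's structure theorem, without a point on the twist, and WITHOUT A SYSTEM.** Hypotheses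
those of `C817a1.depthRow_5_neg8_239_print` ((γ) = Gross 3.7 (2) and F1 = [GZ86 III (3.1)] in place
of the five McCallum/Gross leaves, any imaginary quadratic `K` with `d_K = -8`, any frame, ANY
single datum `d` of conductor `239` — NO system — and its bit `d.kolyvaginClass _ 1 ≠ 0`);
conclusion: `#Sel^(5)(E^{(-8)}/ℚ) ≤ 5` (i.e. `dim_𝔽5 Sel_5(E^{(-8)}/ℚ) ≤ 1`) and the descent count
`5^{rank E^{(-8)}(ℚ)} · #E^{(-8)}(ℚ)[5] · #Ш(E^{(-8)}/ℚ)[5] ≤ 5` — Kolyvagin's second eigen-bound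
`#Sel(E/K)_5^- ≤ 5` read over `ℚ` (kit
`depthRow_twistSelmer_print_of_datum_of_intModel_certificate`; the compatible system through `d` is
the theorem `exists_kolyvaginHeegnerSystem_extending`); the hF-free, twist-point-free counterpart of
the hF-row's `corank Sel_{5^∞}(E^{(-8)}/ℚ) = 1`. CONDITIONAL on (γ) + F1 and the bit; per-curve; BSD
is not proved by it. [cite: Kolyvagin1991MathAnn, Thm. 2.3] [cite: McCallumLMS1991, §§2–5] [cite:
GrossLMS1991, §5 (5.1)] [cite: JetchevLauterStein2009, §3.6 (arXiv:0707.0032)] -/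
theorem twistSelmer_5_neg8_239_print
    (h372 : GrossLMS1991.prop37_2_frobeniusCongruence)
    (hE0 : Gross1991_heegnerPoint_sub_ratTorsion_mem_E0)
    (K : Type) [Field K] [NumberField K] (hK : IsImaginaryQuadratic K)
    (hD : NumberField.discr K = -8) :
    haveI := isElliptic_c817a1;
    haveI := isGloballyMinimal_c817a1;
    haveI : NeZero (((⟨0, 1, 1, 1, 6⟩ : WeierstrassCurve ℤ).map (Int.castRingHom ℚ)).conductorNorm ℤ) :=
      neZero_conductorNorm_of_isElliptic _;
    ∀ (Dt : ModularParametrizationData ((⟨0, 1, 1, 1, 6⟩ : WeierstrassCurve ℤ).map (Int.castRingHom ℚ))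
        (((⟨0, 1, 1, 1, 6⟩ : WeierstrassCurve ℤ).map (Int.castRingHom ℚ)).conductorNorm ℤ)) (β : ℤ)
      (ι : K →+* ℂ) (d : KolyvaginHeegnerData Dt β ι 239),
    d.kolyvaginClass (p := 5) (by norm_num) 1 ≠ 0 →
    Nat.card ↥(selmerGroup (((⟨0, 1, 1, 1, 6⟩ : WeierstrassCurve ℤ).map (Int.castRingHom ℚ)).quadraticTwist
        ((-8 : ℤ) : ℚ)) ((5 : ℕ) : ℤ)) ≤ 5 ∧
      5 ^ (((⟨0, 1, 1, 1, 6⟩ : WeierstrassCurve ℤ).map (Int.castRingHom ℚ)).quadraticTwist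
        ((-8 : ℤ) : ℚ)).mordellWeilRank *
          Nat.card ↥(AddSubgroup.torsionBy (((⟨0, 1, 1, 1, 6⟩ : WeierstrassCurve ℤ).map (Int.castRingHom ℚ)).quadraticTwist
        ((-8 : ℤ) : ℚ)).toAffine.Point ((5 : ℕ) : ℤ)) *
          Nat.card ↥((((⟨0, 1, 1, 1, 6⟩ : WeierstrassCurve ℤ).map (Int.castRingHom ℚ)).quadraticTwist
        ((-8 : ℤ) : ℚ)).sha ⊓
            AddSubgroup.torsionBy (((⟨0, 1, 1, 1, 6⟩ : WeierstrassCurve ℤ).map (Int.castRingHom ℚ)).quadraticTwist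
        ((-8 : ℤ) : ℚ)).galH1 ((5 : ℕ) : ℤ)) ≤ 5 := by
  haveI := isElliptic_c817a1
  haveI := isGloballyMinimal_c817a1
  haveI : NeZero (((⟨0, 1, 1, 1, 6⟩ : WeierstrassCurve ℤ).map (Int.castRingHom ℚ)).conductorNorm ℤ) :=
    neZero_conductorNorm_of_isElliptic _
  intro Dt β ι d hne
  haveI := Fact.mk (by norm_num : Nat.Prime 5)
  exact depthRow_twistSelmer_print_of_datum_of_intModel_certificate intModel h372 hE0 not_hasCM
    KernelCertsR01.C817a1.two_le_rank 5 (by norm_num) hasSurjectiveModNGaloisRep_pow_5 K hK hD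
    (by norm_num) (by norm_num) heegner_neg8 239 (by norm_num) (by norm_num) (by decide +kernel)
    (by norm_num) (by norm_num) (by norm_num) (by norm_num) (n := 240) card_239 (by norm_num) Dt β ι
    d hne

end C817a1

namespace C997b1

/-- **DEPTH-TABLE ROW `997b1`, `(p, d_K, ℓ) = (5, -52, 199)` — THE TWIST'S `5`-SELMER GROUP, without
Kolyvagin's structure theorem, without a point on the twist, and WITHOUT A SYSTEM.** Hypotheses
those of `C997b1.depthRow_5_neg52_199_print` ((γ) = Gross 3.7 (2) and F1 = [GZ86 III (3.1)] in place
of the five McCallum/Gross leaves, any imaginary quadratic `K` with `d_K = -52`, any frame, ANY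
single datum `d` of conductor `199` — NO system — and its bit `d.kolyvaginClass _ 1 ≠ 0`);
conclusion: `#Sel^(5)(E^{(-52)}/ℚ) ≤ 5` (i.e. `dim_𝔽5 Sel_5(E^{(-52)}/ℚ) ≤ 1`) and the descent count
`5^{rank E^{(-52)}(ℚ)} · #E^{(-52)}(ℚ)[5] · #Ш(E^{(-52)}/ℚ)[5] ≤ 5` — Kolyvagin's second eigen-bound
`#Sel(E/K)_5^- ≤ 5` read over `ℚ` (kit
`depthRow_twistSelmer_print_of_datum_of_intModel_certificate`; the compatible system through `d` is
the theorem `exists_kolyvaginHeegnerSystem_extending`); the hF-free, twist-point-free counterpart of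
the hF-row's `corank Sel_{5^∞}(E^{(-52)}/ℚ) = 1`. CONDITIONAL on (γ) + F1 and the bit; per-curve;
BSD is not proved by it. [cite: Kolyvagin1991MathAnn, Thm. 2.3] [cite: McCallumLMS1991, §§2–5]
[cite: GrossLMS1991, §5 (5.1)] [cite: JetchevLauterStein2009, §3.6 (arXiv:0707.0032)] -/
theorem twistSelmer_5_neg52_199_print
    (h372 : GrossLMS1991.prop37_2_frobeniusCongruence)
    (hE0 : Gross1991_heegnerPoint_sub_ratTorsion_mem_E0)
    (K : Type) [Field K] [NumberField K] (hK : IsImaginaryQuadratic K)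
    (hD : NumberField.discr K = -52) :
    haveI := isElliptic_c997b1;
    haveI := isGloballyMinimal_c997b1;
    haveI : NeZero (((⟨0, -1, 1, -5, -3⟩ : WeierstrassCurve ℤ).map (Int.castRingHom ℚ)).conductorNorm ℤ) :=
      neZero_conductorNorm_of_isElliptic _;
    ∀ (Dt : ModularParametrizationData ((⟨0, -1, 1, -5, -3⟩ : WeierstrassCurve ℤ).map (Int.castRingHom ℚ))
        (((⟨0, -1, 1, -5, -3⟩ : WeierstrassCurve ℤ).map (Int.castRingHom ℚ)).conductorNorm ℤ)) (β : ℤ)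
      (ι : K →+* ℂ) (d : KolyvaginHeegnerData Dt β ι 199),
    d.kolyvaginClass (p := 5) (by norm_num) 1 ≠ 0 →
    Nat.card ↥(selmerGroup (((⟨0, -1, 1, -5, -3⟩ : WeierstrassCurve ℤ).map (Int.castRingHom ℚ)).quadraticTwist
        ((-52 : ℤ) : ℚ)) ((5 : ℕ) : ℤ)) ≤ 5 ∧
      5 ^ (((⟨0, -1, 1, -5, -3⟩ : WeierstrassCurve ℤ).map (Int.castRingHom ℚ)).quadraticTwist
        ((-52 : ℤ) : ℚ)).mordellWeilRank *
          Nat.card ↥(AddSubgroup.torsionBy (((⟨0, -1, 1, -5, -3⟩ : WeierstrassCurve ℤ).map (Int.castRingHom ℚ)).quadraticTwist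
        ((-52 : ℤ) : ℚ)).toAffine.Point ((5 : ℕ) : ℤ)) *
          Nat.card ↥((((⟨0, -1, 1, -5, -3⟩ : WeierstrassCurve ℤ).map (Int.castRingHom ℚ)).quadraticTwist
        ((-52 : ℤ) : ℚ)).sha ⊓
            AddSubgroup.torsionBy (((⟨0, -1, 1, -5, -3⟩ : WeierstrassCurve ℤ).map (Int.castRingHom ℚ)).quadraticTwist
        ((-52 : ℤ) : ℚ)).galH1 ((5 : ℕ) : ℤ)) ≤ 5 := by
  haveI := isElliptic_c997b1
  haveI := isGloballyMinimal_c997b1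
  haveI : NeZero (((⟨0, -1, 1, -5, -3⟩ : WeierstrassCurve ℤ).map (Int.castRingHom ℚ)).conductorNorm ℤ) :=
    neZero_conductorNorm_of_isElliptic _
  intro Dt β ι d hne
  haveI := Fact.mk (by norm_num : Nat.Prime 5)
  exact depthRow_twistSelmer_print_of_datum_of_intModel_certificate intModel h372 hE0 not_hasCM
    KernelCertsR01.C997b1.two_le_rank 5 (by norm_num) hasSurjectiveModNGaloisRep_pow_5 K hK hD
    (by norm_num) (by norm_num) heegner_neg52 199 (by norm_num) (by norm_num) (by decide +kernel)
    (by norm_num) (by norm_num) (by norm_num) (by norm_num) (n := 205) card_199 (by norm_num) Dt β ι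
    d hne

end C997b1

end Summit.BirchSwinnertonDyer.BirchSwinnertonDyer.Theorems.KolyvaginDepthDoor

end
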